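import Literature.Probability.LatticeModels.CriticalTwoPointDCPLowerHolds
import HarnessLib

/-!
# Screened axial lower bound from the screened reflected-gradient inequality
# (stub S2 `stub_screenedAxisLower` of line `source-cluster-screening`, crux stmt-CriticalPhenomena-15703
# `Summit.CriticalPhenomena.Ising3DConformalLimit.Theses.SubPtolemyInterlacing.SubPtolemyFloor`)

Topic `Summits/CriticalPhenomena/Ising3DConformalLimit`; theorem-only file (no definition, no named
fact). What is proved: the printed deduction "Theorem 1.2 at scale `4n` ⟹ Theorem 1.3 at scale `n`"
of H. Duminil-Copin, R. Panis, *New lower bounds for the (near) critical Ising and φ⁴ models' two-point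
functions*, CMP 406 (2025) = arXiv:2404.05700 (§1.1, p. 5), at `β = β_c(3)` on `ℤ³`, WITH A POLYNOMIAL
GAIN `n^{s}` (`s ≥ 0`) CARRIED THROUGH: if
`c₀ n^{s} ≤ Σ_{x,y ∈ Λ_n, y ∼ x} (⟨σ₀σ_x⟩ - ⟨σ₀σ_{𝓡_n x}⟩)⟨σ_yσ_{𝓡_n y}⟩` for `n ≥ N₀` (the line's
`ScreenedReflectedGradient s`, unfolded), then
`c₁ n^{s} / (χ_{4n} + n Σ_{1 ≤ k ≤ 2n} k⟨σ₀σ_{ke₁}⟩) ≤ ⟨σ₀σ_{ne₁}⟩` for `n ≥ N₁` (the line's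
`ScreenedAxisLower s`, unfolded), with `c₁ = c₀ / (2d · 2·9^{d-1}(K+18))`, `d = 3`,
`K = 4d #Λ₁ max(β_c,1)`, `N₁ = max(N₀,1)`.

How: the tree's bookkeeping lemma `DCPNearCritical.axis_lower_of_le_sum`
(`SharpLengthDCPFromReflected.lean`) does the whole printed proof for an ABSTRACT per-scale constant
`c`: for `G = ⟨σ₀σ_·⟩_{β_c}` (GKS `0 ≤ G ≤ 1`, `G(0) = 1`; evenness; Messager–Miracle-Solé
`messager_miracleSole_free`; the gradient estimate (1.11) `twoPointFree_gradient_estimate` at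
`m*(β_c) = 0`, `spontaneousMagnetization_eq_zero_of_le_criticalBeta`; `G(e₁) ≥ 1/K` from
`twoPointFree_single_one_lower` and `L(β_c) = ∞`, `sharpLength_criticalBeta_eq_top`) and
`c ≤ Σ_{x ∈ Λ_{4n}} Σ_{y ∼ x} (G x - G(𝓡_{4n}x)) G(y - 𝓡_{4n}y)` it gives
`c / (2d·2·9^{d-1}(K+18)) / (χ_{4n} + n^{d-2} Σ_{k ≤ 2n} k G(ke₁)) ≤ G(ne₁)`. We feed it the hypothesis
at scale `4n` with `c := c₀ (4n)^{s}` (exactly the instantiation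
`dcp_twoPoint_axis_lower_of_reflectedGradient_nearCritical`, at `β = β_c(3)`, without the factor `β`),
and lower the numerator by `(4n)^{s} ≥ n^{s}` (`s ≥ 0`).

## References

* H. Duminil-Copin, R. Panis, CMP 406 (2025), arXiv:2404.05700: Thm. 1.2, Thm. 1.3 and its proof
  (§1.1, p. 5) [DuminilCopinPanis2025LowerBounds].
* A. Messager, S. Miracle-Solé, J. Stat. Phys. 17 (1977) 245 [MessagerMiracleSoleJSP1977].
-/

noncomputable section

open Finset Filter Topology

namespace Summit.CriticalPhenomena.Ising3DConformalLimit.SubPtolemyFloorScreening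

open Literature.Probability.LatticeModels Literature.Probability.LatticeModels.DCPLower
  Literature.Probability.LatticeModels.DCPNearCritical
open scoped Classical

/-- **S2.** For every `s ≥ 0`: the screened reflected-gradient inequality at `β_c(3)` implies the
screened axial lower bound `c₁ n^{s} / (χ_{4n} + n Σ_{1≤k≤2n} k⟨σ₀σ_{ke₁}⟩) ≤ ⟨σ₀σ_{ne₁}⟩` for `n ≥ N₁`.
(Hypothesis and conclusion are the line's `ScreenedReflectedGradient s` / `ScreenedAxisLower s`,
unfolded.) [cite: DuminilCopinPanis2025LowerBounds, Theorem 1.3 and its proof (§1.1, p. 5), with Theorem 1.2] -/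
theorem screenedAxisLower_of_screenedGradient (s : ℝ) (hs : 0 ≤ s)
    (h12 : ∃ c₀ : ℝ, 0 < c₀ ∧ ∃ N₀ : ℕ, 0 < N₀ ∧ ∀ n : ℕ, N₀ ≤ n →
      c₀ * (n : ℝ) ^ s ≤ ∑ x ∈ box 3 n, ∑ y ∈ box 3 n,
        if (zdGraph 3).Adj x y then
          (twoPointFree 3 (criticalBeta 3) x -
              twoPointFree 3 (criticalBeta 3) (dcpReflect (⟨0, by omega⟩ : Fin 3) (n : ℤ) x)) *
            freeExpect 3 (criticalBeta 3) 0
              (spinPair y (dcpReflect (⟨0, by omega⟩ : Fin 3) (n : ℤ) y))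
        else 0) :
    ∃ c₁ : ℝ, 0 < c₁ ∧ ∃ N₁ : ℕ, 0 < N₁ ∧ ∀ n : ℕ, N₁ ≤ n →
      c₁ * (n : ℝ) ^ s / ((∑ x ∈ box 3 (4 * n), twoPointFree 3 (criticalBeta 3) x) +
            (n : ℝ) ^ (3 - 2) *
              ∑ k ∈ Finset.Icc 1 (2 * n),
                (k : ℝ) * twoPointFree 3 (criticalBeta 3) (Pi.single (⟨0, by omega⟩ : Fin 3) (k : ℤ)))
        ≤ twoPointFree 3 (criticalBeta 3) (Pi.single (⟨0, by omega⟩ : Fin 3) (n : ℤ)) := by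
  obtain ⟨c₀, hc₀, N₀, hN₀, hmain⟩ := h12
  set i : Fin 3 := ⟨0, by omega⟩ with hidef
  have hβ : (0 : ℝ) ≤ criticalBeta 3 := criticalBeta_nonneg 3
  -- constants (those of `dcp_twoPoint_axis_lower_of_reflectedGradient_nearCritical` at `d = 3`)
  set B : ℝ := max (criticalBeta 3) 1 with hBdef
  have hB1 : 1 ≤ B := le_max_right _ _
  have hB0 : 0 < B := one_pos.trans_le hB1
  have hβB : criticalBeta 3 ≤ B := le_max_left _ _
  have hcard0 : (0 : ℝ) < #(box 3 1) := by exact_mod_cast card_pos.2 ⟨0, zero_mem_box 3 1⟩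
  have h3pos : (0 : ℝ) < ((3 : ℕ) : ℝ) := by norm_num
  set K : ℝ := 4 * ((3 : ℕ) : ℝ) * #(box 3 1) * B with hKdef
  have hK0 : 0 < K := mul_pos (mul_pos (mul_pos four_pos h3pos) hcard0) hB0
  obtain ⟨E, hEdef⟩ : ∃ E : ℝ, E = 2 * ((3 : ℕ) : ℝ) * (2 * 9 ^ (3 - 1) * (K + 18)) := ⟨_, rfl⟩
  have hE0 : 0 < E := by rw [hEdef]; positivity
  refine ⟨c₀ / E, div_pos hc₀ hE0, max N₀ 1, lt_max_of_lt_right one_pos, fun n hn => ?_⟩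
  have hn1 : 1 ≤ n := le_of_max_le_right hn
  have hnN : N₀ ≤ 4 * n := (le_of_max_le_left hn).trans (by omega)
  -- `L(β_c) = ∞`, so `Λ₁ ∋ 0` is not a witness of Definition 1.1
  have hL1 : (1 : ℕ∞) < sharpLength 3 (criticalBeta 3) := by
    rw [sharpLength_criticalBeta_eq_top (d := 3) (by norm_num)]
    exact ENat.one_lt_top
  set G : Site 3 → ℝ := twoPointFree 3 (criticalBeta 3) with hG
  -- inputs: GKS, Messager–Miracle-Solé, evenness, the gradient estimate (1.11) at `β_c`
  have hG0 : ∀ x, 0 ≤ G x := fun x =>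
    twoPointFree_nonneg hasBoxLimit_isingCorr_free_holds (GKSInequalities.gks_one_holds (zdGraph 3)) hβ x
  have hG1 : ∀ x, G x ≤ 1 := fun x => twoPointFree_le_one hasBoxLimit_isingCorr_free_holds hβ x
  have hGev : ∀ x : Site 3, G (-x) = G x := fun x => by
    simp only [hG]
    rw [← twoPointFree_abs_eq hβ (-x), ← twoPointFree_abs_eq hβ x]
    simp [abs_neg]
  have hmono : ∀ x : Site 3, 0 ≤ x i → G (x + Pi.single i 1) ≤ G x := fun x hx =>
    messager_miracleSole_free hβ x i hx
  have hm : spontaneousMagnetization 3 (criticalBeta 3) = 0 :=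
    spontaneousMagnetization_eq_zero_of_le_criticalBeta (d := 3) (by norm_num) hβ le_rfl
  have hgrad : ∀ (x : Site 3) (j : ℕ), (j : ℤ) ≤ x i →
      G x - G (x + Pi.single i 1) ≤ G (Pi.single i (j : ℤ)) / ((x i : ℝ) - j + 1) :=
    fun x j hj => twoPointFree_gradient_estimate hβ hm i x j hj
  have hG00 : G 0 = 1 := twoPointFree_zero' (criticalBeta 3)
  -- `⟨σ₀σ_{e₁}⟩_{β_c} ≥ 1/K`
  have hgK : K⁻¹ ≤ G (Pi.single i 1) := by
    have h : 1 / 2 ≤ criticalBeta 3 * (2 * ((3 : ℕ) : ℝ) * #(box 3 1)) * G (Pi.single i 1) :=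
      twoPointFree_single_one_lower (d := 3) (by norm_num) hβ hL1
    have hprod : criticalBeta 3 * (2 * ((3 : ℕ) : ℝ) * #(box 3 1)) ≤ K / 2 :=
      calc criticalBeta 3 * (2 * ((3 : ℕ) : ℝ) * #(box 3 1))
          ≤ B * (2 * ((3 : ℕ) : ℝ) * #(box 3 1)) := mul_le_mul_of_nonneg_right hβB (by positivity)
        _ = K / 2 := by rw [hKdef]; ring
    have h2 : 1 / 2 ≤ K / 2 * G (Pi.single i 1) :=
      h.trans (mul_le_mul_of_nonneg_right hprod (hG0 _))
    rw [inv_le_iff_one_le_mul₀ hK0]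
    linarith
  -- the screened Theorem 1.2 at scale `4n` (`4n ≥ N₀`), rewritten in the `Finset.filter`/`axisRefl`
  -- form of `DCPNearCritical.axis_lower_of_le_sum`, which then does the printed bookkeeping
  have h4 := hmain (4 * n) hnN
  have hfinal := DCPNearCritical.axis_lower_of_le_sum (c := c₀ * ((4 * n : ℕ) : ℝ) ^ s) (n := n)
    (le_refl 3) hG0 hG1 hGev hmono hgrad hG00 hK0 hgK hn1 (by
      refine h4.trans_eq ?_
      refine Finset.sum_congr rfl fun x _ => ?_
      rw [Finset.sum_filter]
      refine Finset.sum_congr rfl fun y _ => ?_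
      split_ifs with hxy
      · have hpair : freeExpect 3 (criticalBeta 3) 0 (spinPair y (dcpReflect i ((4 * n : ℕ) : ℤ) y)) =
            G (y - dcpReflect i ((4 * n : ℕ) : ℤ) y) := by
          have h1 : freeExpect 3 (criticalBeta 3) 0 (spinPair y (dcpReflect i ((4 * n : ℕ) : ℤ) y)) =
              twoPointFree 3 (criticalBeta 3) (dcpReflect i ((4 * n : ℕ) : ℤ) y - y) :=
            freePair_eq_twoPointFree_sub hβ y _
          rw [h1, ← hGev]
          congr 1
          abel
        have hR : ∀ z : Site 3,
            dcpReflect i ((4 * n : ℕ) : ℤ) z = axisRefl i (2 * (4 * n : ℕ)) z := by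
          intro z
          funext j
          rw [dcpReflect, Function.update_apply, axisRefl_apply]
        rw [hpair, hR, hR]
      · rfl)
  -- lower the numerator, `c₀ n^{s} ≤ c₀ (4n)^{s}` (`s ≥ 0`), and divide by the nonnegative denominator
  have hpow : (n : ℝ) ^ s ≤ ((4 * n : ℕ) : ℝ) ^ s :=
    Real.rpow_le_rpow (Nat.cast_nonneg n) (by exact_mod_cast (show n ≤ 4 * n by omega)) hs
  have key : c₀ / E * (n : ℝ) ^ s ≤
      c₀ * ((4 * n : ℕ) : ℝ) ^ s / (2 * ((3 : ℕ) : ℝ) * (2 * 9 ^ (3 - 1) * (K + 18))) := by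
    rw [← hEdef, div_mul_eq_mul_div]
    exact div_le_div_of_nonneg_right (mul_le_mul_of_nonneg_left hpow hc₀.le) hE0.le
  have hDnn : 0 ≤ (∑ x ∈ box 3 (4 * n), G x) +
      (n : ℝ) ^ (3 - 2) * ∑ k ∈ Finset.Icc 1 (2 * n), (k : ℝ) * G (Pi.single i (k : ℤ)) :=
    add_nonneg (sum_nonneg fun x _ => hG0 x)
      (mul_nonneg (by positivity) (sum_nonneg fun k _ => mul_nonneg (Nat.cast_nonneg k) (hG0 _)))
  exact (div_le_div_of_nonneg_right key hDnn).trans hfinal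

end Summit.CriticalPhenomena.Ising3DConformalLimit.SubPtolemyFloorScreening

end
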